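import Summits.QuantumFields.GaugeBoot.TiltedBoxLimitDLRBridge
import Summits.QuantumFields.GaugeBoot.TiltedBoxLimitDiagonalRP
import Summits.QuantumFields.GaugeBoot.ClassBIdentification
import HarnessLib

/-!
# Infinite-volume limit points of the 45°-tilted boxes, part 10: DLR states, and Class B from TRANSLATION-INVARIANT uniqueness

HONEST FRAMING (cell `pub-gaugeboot`, page 1 of every file): the venture produces certified bounds
on lattice expectations at stated coupling, gauge group, dimension and torus size; NOT a mass gap,
NOT a continuum limit, NOT a string tension; NOT Yang–Mills-summit-bearing (barriers
`FixedCouplingUltralocality`, `PerturbativeInvisibility`). Structural facts about infinite-volume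
Wilson states and ONE conditional bridge for the open identification `ThermodynamicLimitIsClassB`
(`ClassB.lean`); the hypothesis of the bridge is NOT discharged here.

## Content

* **`mem_ymGibbsMeasures_of_mem_tiltedBoxLimitPoints`** — every tilted limit point
  `μ ∈ tiltedBoxLimitPoints d i j ρ β` is an infinite-volume lattice Yang–Mills Gibbs (DLR) state,
  `μ ∈ ymGibbsMeasures ρ β` (Georgii Thm. 4.17 for the tilted boxes: the boxes satisfy the local DLR
  equations, `TiltedBoxLimitDLRBridge.lean`, the kernels are Feller and quasilocal, and bounded
  continuous functions separate measures — the tree's torus proof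
  `mem_ymGibbsMeasures_of_mem_infiniteVolumeLimitPoints_holds` transplanted);
  **`mem_ymGibbsMeasuresTI_of_mem_tiltedBoxLimitPoints`** — with translation invariance
  (`TiltedBoxLimitInvariance.lean`), `μ ∈ 𝒢_θ(β) = ymGibbsMeasuresTI ρ β`.
* **`torusLimitPointsDiagonalRP_of_subsingleton_TI`** — if the TRANSLATION-INVARIANT DLR states
  are unique, `(ymGibbsMeasuresTI ρ β).Subsingleton` (`|𝒢_θ(β)| ≤ 1`, the hypothesis "S14" of
  `InfiniteVolumeSufficientIV.lean`; weaker than full uniqueness `|𝒢(β)| ≤ 1`, and the form implied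
  by differentiability of the pressure in local sources, Friedli–Velenik Prop. 6.91), then every
  limit point of the CUBIC tori is diagonal-RP in every plane — `TorusLimitPointsDiagonalRP d ρ β` —
  because it coincides with a tilted limit point of each plane `(i, j)`, which is diagonal-RP
  (`TiltedBoxLimitDiagonalRP.lean`) and also lies in `𝒢_θ(β)`. Hence
  **`thermodynamicLimitIsClassB_of_subsingleton_TI`**: `ThermodynamicLimitIsClassB d ρ β` under
  `|𝒢_θ(β)| ≤ 1` (`β ≥ 0`), sharpening the tree's bridge `thermodynamicLimitIsClassB_of_subsingleton`
  (hypothesis `|𝒢(β)| ≤ 1`, via symmetric DLR kernels) — the R9 bridge `H ⇒ C` now holds with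
  `H = uniqueness of the translation-invariant Gibbs state`.

NOT claimed: `|𝒢_θ(β)| ≤ 1` at any particular `β` (known in the tree only inside the
strong-coupling window, where even `|𝒢(β)| ≤ 1` holds); whether tilted and cubic limit points agree
in general (open).

References: H.-O. Georgii, Gibbs Measures and Phase Transitions (2011), Thm. 4.17, (5.4);
S. Friedli, Y. Velenik (2017) Thm. 6.26, Lemma 6.30, Prop. 6.91; E. Seiler, LNP 159 (1982) Ch. 2.
-/

noncomputable section

open MeasureTheory Filter Topology Finset
open Literature.Probability.LatticeModels (Site IsGibbsMeasure)
open Literature.MathematicalPhysics.QuantumLattice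

namespace Summit.QuantumFields.GaugeBoot

namespace TiltedRP

variable {d : ℕ} {i j : Fin d} {N : ℕ}
variable {G : Type*} [Group G] [TopologicalSpace G] [IsTopologicalGroup G] [CompactSpace G]
  [MeasurableSpace G] [BorelSpace G] [SecondCountableTopology G] [T2Space G]
variable (ρ : G →* Matrix (Fin N) (Fin N) ℂ)

/-! ## Tilted limit points are DLR states -/

/-- **Every tilted limit point is an infinite-volume lattice Yang–Mills Gibbs (DLR) state.** -/
theorem mem_ymGibbsMeasures_of_mem_tiltedBoxLimitPoints (hρ : Continuous ρ) {β : ℝ}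
    {μ : Measure (LGConfig d G)} (hμ : μ ∈ tiltedBoxLimitPoints d i j ρ β) :
    μ ∈ ymGibbsMeasures ρ β := by
  classical
  obtain ⟨M, Q, hM, hQ, h⟩ := hμ
  haveI := h.1
  rw [mem_ymGibbsMeasures_iff]
  refine ⟨h.1, fun Λ A hA => ?_⟩
  have hγprob : ∀ η, IsProbabilityMeasure (ymSpecification ρ β Λ η) :=
    isProbabilityMeasure_ymSpecification ρ hρ β Λ
  -- Step 1: `μ(F) = μ(γ_Λ F)` for bounded continuous cylinder observables
  have core_cyl : ∀ (F : LGConfig d G → ℝ) (S₀ : Finset (ZdEdge d)), IsCylinder F S₀ →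
      Continuous F → ∀ C : ℝ, (∀ U, |F U| ≤ C) →
        ∫ U, F U ∂μ = ∫ η, (∫ U, F U ∂(ymSpecification ρ β Λ η)) ∂μ := by
    intro F S₀ hFS hFc C hC
    have h1 := h.tendsto_integral hFS hFc hC
    have h2 := h.tendsto_integral (F := fun η => ∫ U, F U ∂(ymSpecification ρ β Λ η))
      (dependsOn_integral_ymSpecification ρ hρ β Λ hFc.measurable hFS)
      (continuous_integral_ymSpecification ρ hρ β Λ hFc hC)
      (abs_integral_ymSpecification_le ρ hρ β Λ hC)
    have hev : ∀ᶠ k in atTop,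
        ∫ V, F (tiltedLift d i j (M k + 2) (M k + 2) (2 * (Q k + 2)) V)
            ∂(gibbs ρ (tiltedUnit d i j (M k + 2) (M k + 2) (2 * (Q k + 2))) β) =
          ∫ V, (fun η => ∫ U, F U ∂(ymSpecification ρ β Λ η))
              (tiltedLift d i j (M k + 2) (M k + 2) (2 * (Q k + 2)) V)
            ∂(gibbs ρ (tiltedUnit d i j (M k + 2) (M k + 2) (2 * (Q k + 2))) β) := by
      filter_upwards [eventually_injOn_mk (i := i) (j := j) hM hQ
        ((Λ ∪ S₀ ∪ (plaquettesTouching Λ).biUnion plaquetteEdges).image Prod.fst)] with k hk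
      exact integral_tiltedLift_eq_integral_ymSpecification ρ hρ β Λ hFc hC hFS hk
    exact tendsto_nhds_unique (h1.congr' hev) h2
  -- Step 2: extension to all bounded continuous observables by cylinder approximation
  have core : ∀ F : LGConfig d G → ℝ, Continuous F → ∀ C : ℝ, (∀ U, |F U| ≤ C) →
      ∫ U, F U ∂μ = ∫ η, (∫ U, F U ∂(ymSpecification ρ β Λ η)) ∂μ := by
    intro F hFc C hC
    obtain ⟨T, hT⟩ := exists_piecewise_tendsto (E := ZdEdge d) (1 : LGConfig d G)
    have hpc : ∀ n, Continuous fun U : LGConfig d G => (T n).piecewise U 1 := fun n =>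
      continuous_pi fun e => by
        by_cases he : e ∈ T n
        · simp only [Finset.piecewise_eq_of_mem _ _ _ he]; exact continuous_apply e
        · simp only [Finset.piecewise_eq_of_notMem _ _ _ he]; exact continuous_const
    have hcyl : ∀ n, IsCylinder (fun U => F ((T n).piecewise U 1)) (T n) := fun n U U' h =>
      congrArg F ((T n).piecewise_congr (fun e he => h e (Finset.mem_coe.2 he)) fun _ _ => rfl)
    have hlim_μ : Tendsto (fun n => ∫ U, F ((T n).piecewise U 1) ∂μ) atTop (𝓝 (∫ U, F U ∂μ)) :=
      tendsto_integral_of_dominated_convergence (fun _ => C)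
        (fun n => (hFc.comp (hpc n)).aestronglyMeasurable) (integrable_const C)
        (fun n => ae_of_all _ fun U => by simpa [Real.norm_eq_abs] using hC _)
        (ae_of_all _ fun U => (hFc.tendsto U).comp (hT U))
    have hlim_γ : ∀ η, Tendsto (fun n => ∫ U, F ((T n).piecewise U 1) ∂(ymSpecification ρ β Λ η))
        atTop (𝓝 (∫ U, F U ∂(ymSpecification ρ β Λ η))) := fun η =>
      tendsto_integral_of_dominated_convergence (fun _ => C)
        (fun n => (hFc.comp (hpc n)).aestronglyMeasurable) (integrable_const C)
        (fun n => ae_of_all _ fun U => by simpa [Real.norm_eq_abs] using hC _)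
        (ae_of_all _ fun U => (hFc.tendsto U).comp (hT U))
    have hlim_μγ : Tendsto (fun n => ∫ η, (∫ U, F ((T n).piecewise U 1)
        ∂(ymSpecification ρ β Λ η)) ∂μ) atTop
        (𝓝 (∫ η, (∫ U, F U ∂(ymSpecification ρ β Λ η)) ∂μ)) :=
      tendsto_integral_of_dominated_convergence (fun _ => C)
        (fun n => (continuous_integral_ymSpecification ρ hρ β Λ (hFc.comp (hpc n))
          (fun U => hC _)).aestronglyMeasurable)
        (integrable_const C)
        (fun n => ae_of_all _ fun η => by
          simpa [Real.norm_eq_abs] using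
            abs_integral_ymSpecification_le ρ hρ β Λ (F := fun U => F ((T n).piecewise U 1))
              (fun U => hC _) η)
        (ae_of_all _ hlim_γ)
    have heq : (fun n => ∫ U, F ((T n).piecewise U 1) ∂μ) = fun n =>
        ∫ η, (∫ U, F ((T n).piecewise U 1) ∂(ymSpecification ρ β Λ η)) ∂μ :=
      funext fun n => core_cyl _ (T n) (hcyl n) (hFc.comp (hpc n)) C fun U => hC _
    rw [heq] at hlim_μ
    exact tendsto_nhds_unique hlim_μ hlim_μγ
  -- Step 3: `μ = μ γ_Λ` as measures, tested on bounded continuous functions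
  have hκ : Measurable (ymSpecification ρ β Λ) :=
    Measure.measurable_of_measurable_coe _ fun s hs =>
      measurable_ymSpecification_apply ρ hρ β Λ hs
  have hμeq : μ = μ.bind (ymSpecification ρ β Λ) := by
    refine ext_of_forall_lintegral_eq_of_IsFiniteMeasure fun f => ?_
    have hfm : Measurable fun x => (f x : ENNReal) :=
      measurable_coe_nnreal_ennreal.comp f.continuous.measurable
    rw [Measure.lintegral_bind hκ.aemeasurable hfm.aemeasurable]
    have hfc : Continuous fun x => (f x : ℝ) := NNReal.continuous_coe.comp f.continuous
    have hfb : ∀ x, |(f x : ℝ)| ≤ nndist f 0 := fun x => by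
      rw [abs_of_nonneg (f x).coe_nonneg]
      exact_mod_cast BoundedContinuousFunction.NNReal.upper_bound f x
    have hint : ∀ (m : Measure (LGConfig d G)) [IsFiniteMeasure m],
        ∫⁻ x, (f x : ENNReal) ∂m = ENNReal.ofReal (∫ x, (f x : ℝ) ∂m) := by
      intro m _
      rw [← BoundedContinuousFunction.toReal_lintegral_coe_eq_integral,
        ENNReal.ofReal_toReal (BoundedContinuousFunction.lintegral_lt_top_of_nnreal m f).ne]
    have hpt : (fun η => ∫⁻ x, (f x : ENNReal) ∂(ymSpecification ρ β Λ η)) = fun η =>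
        ENNReal.ofReal (∫ x, (f x : ℝ) ∂(ymSpecification ρ β Λ η)) :=
      funext fun η => hint _
    rw [hint μ, hpt, ← ofReal_integral_eq_lintegral_ofReal]
    · rw [core _ hfc _ hfb]
    · exact integrable_of_bound (continuous_integral_ymSpecification ρ hρ β Λ hfc
        hfb).aestronglyMeasurable (abs_integral_ymSpecification_le ρ hρ β Λ hfb)
    · exact ae_of_all _ fun η => integral_nonneg fun x => (f x).coe_nonneg
  -- Step 4: the DLR equation for `A`
  calc ∫⁻ η, ymSpecification ρ β Λ η A ∂μ = (μ.bind (ymSpecification ρ β Λ)) A :=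
        (Measure.bind_apply hA hκ.aemeasurable).symm
    _ = μ A := by rw [← hμeq]

/-- **Tilted limit points are translation-invariant DLR states** (`𝒢_θ(β)`). -/
theorem mem_ymGibbsMeasuresTI_of_mem_tiltedBoxLimitPoints (hρ : Continuous ρ) {β : ℝ}
    {μ : Measure (LGConfig d G)} (hμ : μ ∈ tiltedBoxLimitPoints d i j ρ β) :
    μ ∈ ymGibbsMeasuresTI ρ β :=
  ⟨mem_ymGibbsMeasures_of_mem_tiltedBoxLimitPoints ρ hρ hμ,
    isZdTranslationInvariant_of_mem_tiltedBoxLimitPoints ρ hρ hμ⟩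

/-! ## Class B from uniqueness of the translation-invariant Gibbs state -/

/-- **Under `|𝒢_θ(β)| ≤ 1` every cubic-torus limit point is a tilted limit point of every plane**
(both lie in `𝒢_θ(β)`, and the tilted class is non-empty). -/
theorem mem_tiltedBoxLimitPoints_of_subsingleton_TI (hρ : Continuous ρ) {β : ℝ}
    (hsub : (ymGibbsMeasuresTI (d := d) ρ β).Subsingleton) {μ : Measure (LGConfig d G)}
    (hμ : μ ∈ infiniteVolumeLimitPoints (d := d) ρ β) : μ ∈ tiltedBoxLimitPoints d i j ρ β := by
  obtain ⟨ν, hν⟩ := tiltedBoxLimitPoints_nonempty (d := d) (i := i) (j := j) (ρ := ρ) hρ β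
  have hμν : μ = ν := hsub (mem_ymGibbsMeasuresTI_of_mem_infiniteVolumeLimitPoints ρ hρ hμ)
    (mem_ymGibbsMeasuresTI_of_mem_tiltedBoxLimitPoints ρ hρ hν)
  exact hμν ▸ hν

/-- **`TorusLimitPointsDiagonalRP` from uniqueness of the TRANSLATION-INVARIANT Gibbs state**
(`β ≥ 0`): if `|𝒢_θ(β)| ≤ 1`, every infinite-volume limit point of the cubic torus Wilson states is
reflection positive in every diagonal hyperplane `x_i = x_j` — it is the (diagonal-RP) tilted limit
point of the plane `(i, j)`. Sharpens `torusLimitPointsDiagonalRP_of_subsingleton` (hypothesis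
`|𝒢(β)| ≤ 1`). -/
theorem torusLimitPointsDiagonalRP_of_subsingleton_TI (hρ : Continuous ρ) {β : ℝ} (hβ : 0 ≤ β)
    (hsub : (ymGibbsMeasuresTI (d := d) ρ β).Subsingleton) : TorusLimitPointsDiagonalRP d ρ β :=
  fun _ hμ _ _ hij => diagRP_of_mem_tiltedBoxLimitPoints ρ hij hρ hβ
    (mem_tiltedBoxLimitPoints_of_subsingleton_TI ρ hρ hsub hμ)

/-- **CLASS B HOLDS WHEREVER THE TRANSLATION-INVARIANT DLR STATE IS UNIQUE** (`β ≥ 0`, `d ≥ 1`,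
compact Hausdorff second countable `G`, continuous `ρ`): `|𝒢_θ(β)| ≤ 1 → ThermodynamicLimitIsClassB`.
The hypothesis is weaker than the tree's `|𝒢(β)| ≤ 1` (`thermodynamicLimitIsClassB_of_subsingleton`)
and is not discharged here at any `β` outside the strong-coupling window. -/
theorem thermodynamicLimitIsClassB_of_subsingleton_TI [NeZero d] (hρ : Continuous ρ) {β : ℝ}
    (hβ : 0 ≤ β) (hsub : (ymGibbsMeasuresTI (d := d) ρ β).Subsingleton) :
    ThermodynamicLimitIsClassB d ρ β :=
  (thermodynamicLimitIsClassB_iff ρ hρ hβ).2 (torusLimitPointsDiagonalRP_of_subsingleton_TI ρ hρ hβ hsub)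

/-- **Under `|𝒢_θ(β)| ≤ 1` the tilted and the cubic limit classes coincide** (both are `{the unique
translation-invariant DLR state}`). -/
theorem tiltedBoxLimitPoints_eq_infiniteVolumeLimitPoints_of_subsingleton_TI
    (hρ : Continuous ρ) {β : ℝ} (hsub : (ymGibbsMeasuresTI (d := d) ρ β).Subsingleton) :
    tiltedBoxLimitPoints d i j ρ β = infiniteVolumeLimitPoints (d := d) ρ β := by
  ext μ
  refine ⟨fun hμ => ?_, mem_tiltedBoxLimitPoints_of_subsingleton_TI ρ hρ hsub⟩
  obtain ⟨ν, hν⟩ := infiniteVolumeLimitPoints_nonempty_holds (d := d) ρ hρ β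
  have hμν : μ = ν := hsub (mem_ymGibbsMeasuresTI_of_mem_tiltedBoxLimitPoints ρ hρ hμ)
    (mem_ymGibbsMeasuresTI_of_mem_infiniteVolumeLimitPoints ρ hρ hν)
  exact hμν ▸ hν

end TiltedRP

end Summit.QuantumFields.GaugeBoot
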